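import Literature.MathematicalPhysics.QuantumFieldTheory.Balaban1983to89.B11Eq98V0primeCurrentSlots
import Summits.QuantumFields.YangMills.Theorems.UnitScaleTiltProp7QTwSReality
import Summits.QuantumFields.YangMills.Theorems.UnitScaleTiltProp7SectET3HilbertLettersT3
import HarnessLib

/-!
# Route `UnitScaleTilt`, crux K1 child «MinimiserStabilityRegPr» (stmt-QuantumFields-19200), stub `stub_existenceMinimalOrbit` (EX), route (α) — THE (W-X′) INSTANTIATION OF THE
# DISPLAY'S `Wf`: **LETTER ROWS FOR THE REALITY ROW `hWR`** — the three duality rows of `(ρ₂, τ₂) := (rieszτ frobEquiv, tr)` on `M₂(ℂ)` for the sectors `S = {Hermitian ∧ traceless}`,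
# `Z = ℂ•1`, and the sector row of the A-units chart remainder `C̃ U₀ := fun A′ ↦ (−I) • CmapTwS U₀ ((η·I) • ιA′)`

Cell `ym3-torus`, width seat `ym3-torus-px3` (gen 3; LOCATE «HWR-AT-W80» `ym3-torus-px3/g3/LOCATE-HWR-W80-px3g3.md`).  THEOREMS ONLY (0 `def`, 0 `sorry`); `--supports stmt-QuantumFields-19200
--as helper`; count-neutral.  YM₃ on T³ is a ladder rung (R3), NOT the Clay problem; nothing here claims the stub, the crux, d = 4 or the mass gap.

THE PRINT.  [Balaban1985Variational] (27) p. 282 (the pairing `⟨X, Y⟩ = Σ η^d tr(X Y)` and its dualising map), (44) p. 285 (`C(U₀, A) = log Ū(A) − QA`), (51) p. 286 «for A′ with values in 𝔤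
the configuration D(A′) has values in 𝔤 also», (84)–(89) pp. 290–291 (`W = (δ∕δA′)V`); [Balaban1985BackgroundPropagators] p. 393 «The operators … are real», (3.13)–(3.14).
THE LETTERS OF RECORD (EX namer ★w2-19200 g6, (W) units word 2026-08-28T19:50:28Z (W-X′); px14 ✓`Prop7SectET3WChartConj`): `ρ₂ := rieszτ frobEquiv`, `τ₂ := tr`
(`LinearMap.toContinuousLinearMap (Matrix.traceLinearMap (Fin 2) ℂ ℂ)`), `C̃ U₀ := fun A′ ↦ (−I) • CmapTwS F n K h U₀ (((η:ℂ)·I) • fun b ↦ JetSup.equiv _ _ _ A′ (bondEquiv F K b))`.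

WHAT IS PROVED (sorry-free, no definition; [folklore] `M₂(ℂ)` algebra except where cited).
* §1 `star_trace_mul_of_isHermitian`, `trace_mul_smul_one_of_trace_zero`, ★`trace_rieszτ_frobEquiv_mul` (`tr(ρ₂(ℓ)·X) = ℓ X`: lit ✓`trace_rieszτ_mul` ∘ ✓`inner_frobEquiv_symm`),
  `eq_zero_of_forall_hermitian_traceless_of_one` (a `ℂ`-linear functional killed by the Hermitian traceless matrices and by `1` is `0`), ★★`rieszτ_frobEquiv_isHermitian_trace_zero`
  (`ρ₂(ℓ)` is Hermitian traceless when `ℓ` is real on `S` and `ℓ 1 = 0` — nondegeneracy of `tr`).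
* §2 THE THREE DUALITY ROWS OF lit ✓`B11Eq80CurrentRealSubspace.W80_apply_mem` IN ITS BINDER FORM, for any `ℝ`-submodules `S`, `Z` characterised by «Hermitian ∧ traceless» ∕ «`∃ c, X = c•1`»:
  ★`hτS_trace`, ★`hτZ_trace`, ★★`hρ_rieszτ_frobEquiv`.
* §3 ★`CmapTwS_skewHermitian_traceless_of_ball` (the re-based twisted remainder is `𝔰𝔲(2)`-valued on `‖A(b)‖ ≤ e·η` at `U₀ ∈ 𝔘_k(ε₀)`: ✓`logChartTwS_skewHermitian_of_ball` ∘
  ✓`dbarTwS_mem_specialUnitaryUnits_of_skewHermitian` and ✓`QTwS_skewHermitian_traceless_of_regPr`), ★★`Ctilde_isHermitian_trace_zero_of_ball` = the row `hC` of ✓`W80_apply_mem` at the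
  (W-X′) letter `C̃` on the ball `‖A′‖ < c₄ ≤ e` of the space (115) (weights `1` at `lev ≡ K − n`, ✓`levWeight_const_eq_one`).
HONEST SCOPE.  Linear algebra and bookkeeping over landed reality theorems; no estimate; windows `10⁹L²e ≤ 1`, `10¹²L³ε₀ ≤ 1` as in the suppliers; nothing of Props 3–4 asserted.

References: T. Bałaban, CMP **102** (1985) 277–309 [Balaban1985Variational] ((27) p.282, (44) p.285, (51) p.286, (84)–(89) pp.290–291, (115) p.294); CMP **99** (1985) 389–434
[Balaban1985BackgroundPropagators] (p.393, (3.13)–(3.14)); CMP **98** (1985) 17–51 [Balaban1985Averaging] ((18) p.21).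
-/

set_option autoImplicit false

noncomputable section

open scoped InnerProductSpace ComplexConjugate Matrix.Norms.L2Operator BigOperators
open Metric Set Filter Topology

namespace Summit.QuantumFields.YangMills.Theorems.Prop7SectET3WCurrentRealityLetters

open Literature.MathematicalPhysics.QuantumFieldTheory.Balaban1983to89
open Literature.MathematicalPhysics.QuantumFieldTheory.Balaban1983to89.T3ContinuumYM3Torus
open T3SectALandauChart (eta eta_pos)
open T3PrintedRegularMinimiser (RegPr)
open B9SectCLatticeCarrier (Bond)
open B11Eq115Space (NegSup NegSize Space115 JetSup levWeight)
open B11Eq111FrakG (nabla115)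
open B11Eq98V0primeCurrentSlots (rieszτ trace_rieszτ_mul)
open Summit.QuantumFields.YangMills.Theorems.Prop7SectET3Transport (periodsT3 siteEquiv bondEquiv bgOfCfg)
open Summit.QuantumFields.YangMills.Theorems.Prop7SectET3HilbertLetters (W₂ frobEquiv inner_frobEquiv_symm toL2)
open Summit.QuantumFields.YangMills.Theorems.Prop7SymAvgTwSym (logChartTwS QTwS CmapTwS)
open Summit.QuantumFields.YangMills.Theorems.Prop7ChartRealityTwS (logChartTwS_skewHermitian_of_ball dbarTwS_mem_specialUnitaryUnits_of_skewHermitian)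
open Summit.QuantumFields.YangMills.Theorems.Prop7QTwSReality (QTwS_skewHermitian_traceless_of_regPr)

/-! ## §1 `M₂(ℂ)` letter rows: the duality rows of `(ρ₂, τ₂) := (rieszτ frobEquiv, tr)` for the sectors `S = {Hermitian ∧ traceless}`, `Z = ℂ•1` -/

section Duality

/-- `tr(XY)` is real for Hermitian `X`, `Y`. [folklore] -/
theorem star_trace_mul_of_isHermitian {X Y : Matrix (Fin 2) (Fin 2) ℂ} (hX : X.IsHermitian) (hY : Y.IsHermitian) :
    star ((X * Y).trace) = (X * Y).trace := by
  rw [← Matrix.trace_conjTranspose, Matrix.conjTranspose_mul, hX.eq, hY.eq, Matrix.trace_mul_comm]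

/-- `tr(X · c•1) = 0` for traceless `X`. [folklore] -/
theorem trace_mul_smul_one_of_trace_zero {X : Matrix (Fin 2) (Fin 2) ℂ} (hX : X.trace = 0) (c : ℂ) :
    (X * (c • (1 : Matrix (Fin 2) (Fin 2) ℂ))).trace = 0 := by
  rw [Matrix.mul_smul, Matrix.mul_one, Matrix.trace_smul, hX, smul_zero]

/-- **THE DUALISING MAP OF (27) AT `(ρ₂, τ₂) := (rieszτ frobEquiv, tr)`: `tr(ρ₂(ℓ)·X) = ℓ X`** (lit ✓`trace_rieszτ_mul` with the cell's norming ✓`inner_frobEquiv_symm`).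
[cite: Balaban1985Variational, (27) p.282; Balaban1985Averaging, (18) p.21] -/
theorem trace_rieszτ_frobEquiv_mul (ℓ : Matrix (Fin 2) (Fin 2) ℂ →L[ℂ] ℂ) (X : Matrix (Fin 2) (Fin 2) ℂ) :
    (rieszτ frobEquiv ℓ * X).trace = ℓ X := by
  have key := trace_rieszτ_mul frobEquiv (LinearMap.toContinuousLinearMap (Matrix.traceLinearMap (Fin 2) ℂ ℂ))
    (fun X Y => by rw [inner_frobEquiv_symm]; rfl) ℓ X
  exact key

/-- Entrywise test for Hermitian-ness of the explicit `M₂(ℂ)` combinations below. [folklore] -/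
theorem isHermitian_half_add_conjTranspose (X : Matrix (Fin 2) (Fin 2) ℂ) : ((2 : ℂ)⁻¹ • (X + X.conjTranspose)).IsHermitian := by
  refine Matrix.IsHermitian.ext fun i j => ?_
  simp only [Matrix.smul_apply, Matrix.add_apply, Matrix.conjTranspose_apply, smul_eq_mul, star_mul', star_add, Complex.star_def, Complex.conj_conj, map_inv₀,
    map_ofNat]
  ring

/-- Entrywise test, second combination. [folklore] -/
theorem isHermitian_half_negI_sub_conjTranspose (X : Matrix (Fin 2) (Fin 2) ℂ) :
    ((2 : ℂ)⁻¹ • (-Complex.I • (X - X.conjTranspose))).IsHermitian := by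
  refine Matrix.IsHermitian.ext fun i j => ?_
  simp only [Matrix.smul_apply, Matrix.sub_apply, Matrix.conjTranspose_apply, smul_eq_mul, star_mul', star_sub, star_neg, Complex.star_def, Complex.conj_conj,
    map_inv₀, map_ofNat, Complex.conj_I]
  ring

/-- `X = H₁ + i·H₂` with the two Hermitian combinations. [folklore] -/
theorem eq_herm_add_I_smul_herm (X : Matrix (Fin 2) (Fin 2) ℂ) :
    X = ((2 : ℂ)⁻¹ • (X + X.conjTranspose)) + Complex.I • ((2 : ℂ)⁻¹ • (-Complex.I • (X - X.conjTranspose))) := by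
  ext i j
  simp only [Matrix.add_apply, Matrix.smul_apply, Matrix.sub_apply, smul_eq_mul]
  linear_combination ((2 : ℂ)⁻¹ * (X i j - X.conjTranspose i j)) * Complex.I_mul_I

/-- A Hermitian matrix minus half its trace times `1` is Hermitian and traceless. [folklore] -/
theorem isHermitian_trace_zero_sub_half_trace {Y : Matrix (Fin 2) (Fin 2) ℂ} (hY : Y.IsHermitian) :
    (Y - ((2 : ℂ)⁻¹ * Y.trace) • (1 : Matrix (Fin 2) (Fin 2) ℂ)).IsHermitian ∧ (Y - ((2 : ℂ)⁻¹ * Y.trace) • (1 : Matrix (Fin 2) (Fin 2) ℂ)).trace = 0 := by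
  have hreal : star Y.trace = Y.trace := by rw [← Matrix.trace_conjTranspose, hY.eq]
  refine ⟨?_, ?_⟩
  · refine Matrix.IsHermitian.sub hY ?_
    rw [Matrix.IsHermitian, Matrix.conjTranspose_smul, Matrix.conjTranspose_one, star_mul', hreal, star_inv₀, star_ofNat]
  · rw [Matrix.trace_sub, Matrix.trace_smul, Matrix.trace_one, Fintype.card_fin, smul_eq_mul]
    push_cast
    ring

/-- A `ℂ`-linear functional on `M₂(ℂ)` vanishing on the Hermitian traceless matrices and on `1` vanishes identically (`X = H₁ + iH₂`, `H = H₀ + ½(tr H)•1`). [folklore] -/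
theorem eq_zero_of_forall_hermitian_traceless_of_one (f : Matrix (Fin 2) (Fin 2) ℂ →ₗ[ℂ] ℂ)
    (hS : ∀ Y : Matrix (Fin 2) (Fin 2) ℂ, Y.IsHermitian → Y.trace = 0 → f Y = 0) (h1 : f 1 = 0) (X : Matrix (Fin 2) (Fin 2) ℂ) : f X = 0 := by
  -- every Hermitian matrix is killed
  have hH : ∀ Y : Matrix (Fin 2) (Fin 2) ℂ, Y.IsHermitian → f Y = 0 := by
    intro Y hY
    have hsplit : Y = (Y - ((2 : ℂ)⁻¹ * Y.trace) • (1 : Matrix (Fin 2) (Fin 2) ℂ)) + ((2 : ℂ)⁻¹ * Y.trace) • (1 : Matrix (Fin 2) (Fin 2) ℂ) := by abel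
    obtain ⟨hherm, htr⟩ := isHermitian_trace_zero_sub_half_trace hY
    rw [hsplit, map_add, hS _ hherm htr, map_smul, h1, smul_zero, add_zero]
  rw [eq_herm_add_I_smul_herm X, map_add, hH _ (isHermitian_half_add_conjTranspose X), map_smul, hH _ (isHermitian_half_negI_sub_conjTranspose X),
    smul_zero, add_zero]

open scoped ComplexOrder in
/-- ★★ **`ρ₂(ℓ)` IS HERMITIAN TRACELESS when `ℓ` is real on the Hermitian traceless matrices and vanishes at `1`** — the row `hρ` of lit ✓`W80_apply_mem` at `(ρ₂, τ₂)`: `tr ρ₂(ℓ) = ℓ 1 = 0`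
and `tr((ρ₂(ℓ)ᴴ − ρ₂(ℓ))X) = 0` on Hermitian traceless `X` and on `1`, hence for all `X`. [cite: Balaban1985Variational, (27) p.282, (51) p.286] -/
theorem rieszτ_frobEquiv_isHermitian_trace_zero (ℓ : Matrix (Fin 2) (Fin 2) ℂ →L[ℂ] ℂ)
    (hS : ∀ Y : Matrix (Fin 2) (Fin 2) ℂ, Y.IsHermitian → Y.trace = 0 → star (ℓ Y) = ℓ Y) (h1 : ℓ 1 = 0) :
    (rieszτ frobEquiv ℓ).IsHermitian ∧ (rieszτ frobEquiv ℓ).trace = 0 := by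
  set R := rieszτ frobEquiv ℓ with hR
  have hdual : ∀ X, (R * X).trace = ℓ X := trace_rieszτ_frobEquiv_mul ℓ
  have hRtr : R.trace = 0 := by have h := hdual 1; rwa [Matrix.mul_one, h1] at h
  refine ⟨?_, hRtr⟩
  -- the functional `X ↦ tr((Rᴴ − R) X)` vanishes on Hermitian traceless `X` and on `1`
  let f : Matrix (Fin 2) (Fin 2) ℂ →ₗ[ℂ] ℂ :=
    { toFun := fun X => ((R.conjTranspose - R) * X).trace
      map_add' := fun X Y => by simp only [Matrix.mul_add, Matrix.trace_add]
      map_smul' := fun c X => by simp only [Matrix.mul_smul, Matrix.trace_smul, RingHom.id_apply] }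
  have hf : ∀ X, f X = ((R.conjTranspose - R) * X).trace := fun X => rfl
  have hfS : ∀ Y : Matrix (Fin 2) (Fin 2) ℂ, Y.IsHermitian → Y.trace = 0 → f Y = 0 := by
    intro Y hY hYtr
    rw [hf, Matrix.sub_mul, Matrix.trace_sub, hdual, sub_eq_zero]
    have : (R.conjTranspose * Y).trace = star ((R * Y).trace) := by
      rw [← Matrix.trace_conjTranspose, Matrix.conjTranspose_mul, hY.eq, Matrix.trace_mul_comm]
    rw [this, hdual, hS Y hY hYtr]
  have hf1 : f 1 = 0 := by
    rw [hf, Matrix.mul_one, Matrix.trace_sub, Matrix.trace_conjTranspose, hRtr, star_zero, sub_self]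
  have hzero : ∀ X, f X = 0 := eq_zero_of_forall_hermitian_traceless_of_one f hfS hf1
  -- nondegeneracy of the trace pairing: take `X := (Rᴴ − R)ᴴ`
  have hRR : R.conjTranspose - R = 0 := by
    have h := hzero (R.conjTranspose - R).conjTranspose
    rw [hf] at h
    exact Matrix.trace_mul_conjTranspose_self_eq_zero_iff.1 h
  exact sub_eq_zero.1 hRR

end Duality


/-! ## §2 The three duality rows of lit ✓`W80_apply_mem` in binder form, for any `ℝ`-submodules `S`, `Z` characterised by «Hermitian ∧ traceless» and «`ℂ•1`» -/

section DualityRows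

variable (S Z : Submodule ℝ (Matrix (Fin 2) (Fin 2) ℂ)) (hS : ∀ X : Matrix (Fin 2) (Fin 2) ℂ, X ∈ S ↔ X.IsHermitian ∧ X.trace = 0)
  (hZ : ∀ X : Matrix (Fin 2) (Fin 2) ℂ, X ∈ Z ↔ ∃ c : ℂ, X = c • (1 : Matrix (Fin 2) (Fin 2) ℂ))

include hS in
/-- ★ **ROW `hτS` at `τ₂ := tr`**: `tr(XY) ∈ ℝ` on `S × S`. [cite: Balaban1985Variational, (27) p.282, (51) p.286] -/
theorem hτS_trace : ∀ X ∈ S, ∀ Y ∈ S, starRingEnd ℂ ((LinearMap.toContinuousLinearMap (Matrix.traceLinearMap (Fin 2) ℂ ℂ)) (X * Y))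
      = (LinearMap.toContinuousLinearMap (Matrix.traceLinearMap (Fin 2) ℂ ℂ)) (X * Y) := fun X hX Y hY => by
  show starRingEnd ℂ ((X * Y).trace) = (X * Y).trace
  exact star_trace_mul_of_isHermitian ((hS X).1 hX).1 ((hS Y).1 hY).1

include hS hZ in
/-- ★ **ROW `hτZ` at `τ₂ := tr`**: `tr(X z) = 0` for `X ∈ S`, `z ∈ Z`. [cite: Balaban1985Variational, (27) p.282, (51) p.286] -/
theorem hτZ_trace : ∀ X ∈ S, ∀ z ∈ Z, (LinearMap.toContinuousLinearMap (Matrix.traceLinearMap (Fin 2) ℂ ℂ)) (X * z) = 0 := fun X hX z hz => by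
  obtain ⟨c, rfl⟩ := (hZ z).1 hz
  show (X * (c • (1 : Matrix (Fin 2) (Fin 2) ℂ))).trace = 0
  exact trace_mul_smul_one_of_trace_zero ((hS X).1 hX).2 c

include hS hZ in
/-- ★★ **ROW `hρ` at `ρ₂ := rieszτ frobEquiv`**: a functional real on `S` and zero on `Z` dualises into `S`. [cite: Balaban1985Variational, (27) p.282, (51) p.286] -/
theorem hρ_rieszτ_frobEquiv : ∀ ℓ : Matrix (Fin 2) (Fin 2) ℂ →L[ℂ] ℂ, (∀ Y ∈ S, starRingEnd ℂ (ℓ Y) = ℓ Y) → (∀ z ∈ Z, ℓ z = 0) → rieszτ frobEquiv ℓ ∈ S :=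
  fun ℓ hℓS hℓZ => (hS _).2 (rieszτ_frobEquiv_isHermitian_trace_zero ℓ (fun Y hY hYtr => hℓS Y ((hS Y).2 ⟨hY, hYtr⟩))
    (hℓZ 1 ((hZ 1).2 ⟨1, (one_smul ℂ _).symm⟩)))

end DualityRows

/-! ## §3 The sector row `hC` of the (W-X′) chart remainder `C̃ U₀ := fun A′ ↦ (−I) • CmapTwS U₀ (κ_f • ιA′)` -/

section ChartRow

variable (F : T3Family) {n K : ℕ} (h : n ≤ K) [Fact (0 < (F.L : ℝ))] [Fact (0 < ((F.L : ℝ)⁻¹) ^ (K - n))]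

/-- ★ **THE RE-BASED TWISTED REMAINDER `C = log U̿ˢ − Q` IS `𝔰𝔲(2)`-VALUED ON THE BALL `‖A(b)‖ ≤ e·η`** at `U₀ ∈ 𝔘_k(ε₀)` in the two windows: the log-chart is (✓`logChartTwS_skewHermitian_of_ball`
with ✓`dbarTwS_mem_specialUnitaryUnits_of_skewHermitian`) and so is its linear part (✓`QTwS_skewHermitian_traceless_of_regPr`).
[cite: Balaban1985Variational, (44) p.285, (51) p.286; Balaban1985BackgroundPropagators, (3.13)–(3.14) p.393] -/
theorem CmapTwS_skewHermitian_traceless_of_ball {ε₀ e : ℝ} (hε₀ : 0 < ε₀) (he : 0 < e) (hWe : 10 ^ 9 * (F.L : ℝ) ^ 2 * e ≤ 1) (hWε : 10 ^ 12 * (F.L : ℝ) ^ 3 * ε₀ ≤ 1)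
    (U₀ : GaugeField (F.P K) 0 (Matrix.specialUnitaryGroup (Fin 2) ℂ)) (hreg : RegPr F n K ε₀ U₀)
    (A : PBond (F.P K) 0 → Matrix (Fin 2) (Fin 2) ℂ) (hA : ∀ b, star (A b) = -A b ∧ (A b).trace = 0) (hAe : ∀ b, ‖A b‖ ≤ e * eta F n K)
    (c : PBond (F.P n) 0) : star (CmapTwS F n K h U₀ A c) = -CmapTwS F n K h U₀ A c ∧ (CmapTwS F n K h U₀ A c).trace = 0 := by
  have hlog := logChartTwS_skewHermitian_of_ball F h hε₀ he.le hWe hWε U₀ hreg A hAe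
    (fun c' => dbarTwS_mem_specialUnitaryUnits_of_skewHermitian F h hε₀ he.le hWe hWε U₀ hreg A hA hAe c') c
  have hQ := QTwS_skewHermitian_traceless_of_regPr F h hε₀ he hWe hWε U₀ hreg A hA c
  rw [Prop7SymAvgTwSym.CmapTwS_apply]
  refine ⟨?_, ?_⟩
  · rw [Pi.sub_apply, star_sub, hlog.1, hQ.1, neg_sub_neg, neg_sub]
  · rw [Pi.sub_apply, Matrix.trace_sub, hlog.2, hQ.2, sub_zero]

/-- `(−I)•Y` is Hermitian traceless for `𝔰𝔲(2)`-valued `Y`. [folklore] -/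
theorem isHermitian_trace_zero_negI_smul {Y : Matrix (Fin 2) (Fin 2) ℂ} (hY : star Y = -Y ∧ Y.trace = 0) :
    ((-Complex.I) • Y).IsHermitian ∧ ((-Complex.I) • Y).trace = 0 := by
  refine ⟨?_, by rw [Matrix.trace_smul, hY.2, smul_zero]⟩
  rw [Matrix.IsHermitian, Matrix.conjTranspose_smul, star_neg, Complex.star_def, Complex.conj_I, neg_neg, ← Matrix.star_eq_conjTranspose, hY.1, smul_neg,
    neg_smul]

/-- `(η·I)•X` is `𝔰𝔲(2)`-valued for Hermitian traceless `X`, with norm `η·‖X‖`. [folklore] -/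
theorem skewHermitian_etaI_smul {X : Matrix (Fin 2) (Fin 2) ℂ} (hX : X.IsHermitian ∧ X.trace = 0) (η : ℝ) :
    star (((((η : ℝ) : ℂ)) * Complex.I) • X) = -(((((η : ℝ) : ℂ)) * Complex.I) • X) ∧ ((((( η : ℝ) : ℂ)) * Complex.I) • X).trace = 0 := by
  refine ⟨?_, by rw [Matrix.trace_smul, hX.2, smul_zero]⟩
  rw [star_smul, Matrix.star_eq_conjTranspose, hX.1.eq, star_mul', Complex.star_def, Complex.conj_ofReal, Complex.conj_I, mul_neg, neg_smul]

/-- ★★ **ROW `hC` AT THE (W-X′) LETTERS**: for `U₀ ∈ 𝔘_k(ε₀)` in the windows and `c₄ ≤ e`, the A-units chart remainder `C̃ U₀ := fun A′ ↦ (−I) • CmapTwS U₀ ((η·I) • ιA′)` maps every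
Hermitian-traceless-valued `A′` of the ball `‖A′‖ < c₄` of the space (115) to Hermitian-traceless block data (`‖(η·I)•ιA′(b)‖ = η‖A′(b)‖ ≤ η·‖A′‖` — the (115)-weights are `1` at
`lev ≡ K − n`). [cite: Balaban1985Variational, (44) p.285, (51) p.286, (115) p.294] -/
theorem Ctilde_isHermitian_trace_zero_of_ball {ε₀ e c₄ : ℝ} (hε₀ : 0 < ε₀) (he : 0 < e) (hWe : 10 ^ 9 * (F.L : ℝ) ^ 2 * e ≤ 1) (hWε : 10 ^ 12 * (F.L : ℝ) ^ 3 * ε₀ ≤ 1)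
    (hc₄ : c₄ ≤ e) (U₀ : GaugeField (F.P K) 0 (Matrix.specialUnitaryGroup (Fin 2) ℂ)) (hreg : RegPr F n K ε₀ U₀)
    (A' : Space115 (F.L : ℝ) (((F.L : ℝ)⁻¹) ^ (K - n)) (fun _ : Bond 3 (periodsT3 F K) => K - n)
      (fun _ : Bond 3 (periodsT3 F K) × Fin 3 => K - n) (nabla115 (((F.L : ℝ)⁻¹) ^ (K - n)) (bgOfCfg F K U₀)))
    (hA' : ‖A'‖ < c₄) (hA'S : ∀ b, (JetSup.equiv _ _ _ A' b).IsHermitian ∧ (JetSup.equiv _ _ _ A' b).trace = 0) (c : PBond (F.P n) 0) :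
    (((-Complex.I) • CmapTwS F n K h U₀ (((((eta F n K : ℝ) : ℂ)) * Complex.I) • fun b : PBond (F.P K) 0 => JetSup.equiv _ _ _ A' (bondEquiv F K b))) c).IsHermitian ∧
    (((-Complex.I) • CmapTwS F n K h U₀ (((((eta F n K : ℝ) : ℂ)) * Complex.I) • fun b : PBond (F.P K) 0 => JetSup.equiv _ _ _ A' (bondEquiv F K b))) c).trace = 0 := by
  have hL : (F.L : ℝ) ≠ 0 := (Fact.out : 0 < (F.L : ℝ)).ne'
  -- the 0-jet is pointwise below the (115)-norm (weights `1`)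
  have hpt : ∀ b : PBond (F.P K) 0, ‖JetSup.equiv _ _ _ A' (bondEquiv F K b)‖ ≤ ‖A'‖ := fun b => by
    have h1 := NegSup.norm_apply_le (JetSup.fst A') (bondEquiv F K b)
    rw [JetSup.equiv_fst, Prop7SectET3Transport.levWeight_const_eq_one hL, inv_one, one_mul] at h1
    exact h1.trans (JetSup.norm_fst_le A')
  have hAe : ∀ b : PBond (F.P K) 0, ‖((((( eta F n K : ℝ) : ℂ)) * Complex.I) • fun b : PBond (F.P K) 0 => JetSup.equiv _ _ _ A' (bondEquiv F K b)) b‖ ≤ e * eta F n K := by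
    intro b
    rw [Pi.smul_apply, norm_smul, norm_mul, Complex.norm_real, Complex.norm_I, mul_one, Real.norm_of_nonneg (eta_pos F n K).le, mul_comm]
    exact mul_le_mul_of_nonneg_right ((hpt b).trans (hA'.le.trans hc₄)) (eta_pos F n K).le
  have hsk : ∀ b : PBond (F.P K) 0, star (((((( eta F n K : ℝ) : ℂ)) * Complex.I) • fun b : PBond (F.P K) 0 => JetSup.equiv _ _ _ A' (bondEquiv F K b)) b)
      = -((((( eta F n K : ℝ) : ℂ)) * Complex.I) • fun b : PBond (F.P K) 0 => JetSup.equiv _ _ _ A' (bondEquiv F K b)) b ∧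
      ((((((eta F n K : ℝ) : ℂ)) * Complex.I) • fun b : PBond (F.P K) 0 => JetSup.equiv _ _ _ A' (bondEquiv F K b)) b).trace = 0 := fun b =>
    skewHermitian_etaI_smul (hA'S (bondEquiv F K b)) (eta F n K)
  have key := CmapTwS_skewHermitian_traceless_of_ball F h hε₀ he hWe hWε U₀ hreg _ hsk hAe c
  rw [Pi.smul_apply]
  exact isHermitian_trace_zero_negI_smul key

end ChartRow

end Summit.QuantumFields.YangMills.Theorems.Prop7SectET3WCurrentRealityLetters

end
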